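import Literature.LinearAlgebra.Matrix.PositiveMapKantorovichInequalities
import HarnessLib

/-!
# The Bhatia–Davis inequality for unital positive linear maps `Φ(A²) − Φ(A)² ≤ (MI − Φ(A))(Φ(A) − mI) ≤ ¼(M − m)²I`,
# the reverse Kadison inequality `Φ(A²) ≤ ((M+m)²/(4Mm)) Φ(A)²`, and Kadison's inequality `Φ(A)² ≤ Φ(A²)` for
# Hermitian `A`

Hodge foundations lane (`lit-hodgefound`, prover p24 gen 62; matrix-analysis series, sequel of
`PositiveMapKantorovichInequalities.lean` (Marshall–Olkin `Φ(A⁻¹) ≤ KΦ(A)⁻¹`) and `PositiveMapKadisonChoiInequalities.lean`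
(Kadison for `A ⪰ 0`)).  THEOREMS ONLY: no definition, no named fact, net debt 0.  Matrices over `𝕜 = ℝ` or `ℂ`
(`[RCLike 𝕜]`; § 4 over `ℂ`); `Y ≤ Z` (Loewner) is `(Z - Y).PosSemidef`; real constants are cast into `𝕜`;
`Φ : Matrix n n 𝕜 →ₗ[𝕜] Matrix k k 𝕜` is positive (`hΦ`) and unital (`hΦ1`); «`mI ≤ A ≤ MI`» are the two Loewner
hypotheses `hmA`, `hAM` (so `A` is Hermitian).

## Sources, VERBATIM

* [SharmaKumari2015] R. Sharma, R. Kumari, *Positive linear maps and perturbation bounds of matrices*, arXiv:1509.05674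
  (held text `paper:arxiv-1509.05674`), § 1 p. 2: «A linear map `Φ : 𝕄(n) → 𝕄(k)` is called positive if `Φ(A)` is
  positive semidefinite (psd) whenever `A` has that property, and unital if `Φ(I) = I`. … Bhatia and Davis [3] have proved
  that if `Φ` is any positive unital linear map and the spectrum of any Hermitian matrix `A` is contained in the interval
  `[m, M]`, then `Φ(A²) − Φ(A)² ≤ (M − m)²/4`. (1.1)»; § 3 p. 7: «Also, `m ≤ A ≤ M` therefore `m ≤ Φ(A) ≤ M`. (3.9) …
  Let `Φ : 𝕄(n) → 𝕄(k)` be a positive unital linear map. Let `A` be a Hermitian element of `𝕄(n)` such that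
  `mI ≤ A ≤ MI`. Bhatia and Davis [3] have proved that `Φ(A²) − Φ(A)² ≤ (M − Φ(A))(Φ(A) − m)`. (3.10)»
  ([3] = [BhatiaDavis2000] R. Bhatia, C. Davis, *A better bound on the variance*, Amer. Math. Monthly 107 (2000) 353–357.)
* [SababhehEtAl2019] M. Sababheh, H. R. Moradi, I. H. Gümüş, S. Furuichi, *A note on Kantorovich and Ando inequalities*,
  arXiv:1911.12915 (held text `paper:arxiv-1911.12915`), § 1 p. 3: «The Choi–Davis inequality states that
  `f(Φ(A)) ≤ Φ(f(A))`, (1) for all self adjoint operators `A` with spectra in the interval `J`, all operator convex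
  functions `f : J → ℝ` and all unital positive linear mappings `Φ`. … The inequality (2) can be reversed under the
  additional condition that `0 < mI ≤ A ≤ MI` …  `Φ(A⁻¹) ≤ ((M+m)²/(4Mm)) Φ(A)⁻¹`. (3)  Among many other equivalences, we
  shall prove that (3) is equivalent to `Φ(A²) ≤ ((M+m)²/(4Mm)) Φ(A)²`. (4)»; Theorem 3.1 (p. 5): «Let `A` satisfying
  `mI ≤ A ≤ MI` for some scalars `0 < m < M`. Then the following assertions are equivalent. (i) `Φ(A⁻¹) ≤
  ((M+m)/(2√(Mm)))² Φ(A)⁻¹` for any unital positive linear mapping `Φ` … (iv) `Φ(A²) ≤ ((M+m)/(2√(Mm)))² Φ(A)²` for any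
  unital positive linear mapping `Φ`.»; Remark 3.1 (p. 7): «Notice that the case `p = 2` in (6) reduces to
  `Φ(A²) ≤ ((M+m)/(2√(Mm)))² Φ(A)²`. (7)»

## What is formalized (all PROVED), and the roads

* § 1 (3.9) **`map_loewner_bounds`** (`mI ≤ Φ(A) ≤ MI`); `map_sq_le_affine` (`Φ(A²) ≤ (M+m)Φ(A) − MmI`, the image of
  `A² ≤ (M+m)A − MmI`, i.e. of `(MI − A)(A − mI) ⪰ 0` — the tree's `MatrixKantorovich.sq_le_of_eigenvalues_le`).
* § 2 **Bhatia–Davis** (3.10) **`map_sq_sub_sq_map_le_mul`** (`Φ(A²) − Φ(A)² ≤ (MI − Φ(A))(Φ(A) − mI)` — which IS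
  § 1 after subtracting `Φ(A)²`, the two factors commuting) and (1.1) **`map_sq_sub_sq_map_le`**
  (`Φ(A²) − Φ(A)² ≤ ¼(M − m)²I`, since `(MI − C)(C − mI) = ¼(M−m)²I − (C − ½(M+m)I)²`).
* § 3 **(4)/(7)/Theorem 3.1 (iv)** **`map_sq_le_smul_sq_map`** (`Φ(A²) ≤ ((M+m)²/(4Mm)) Φ(A)²` for `0 < m`, from § 1 and
  the tree's `(M+m)C − MmI ≤ ((M+m)²/(4Mm))C²`, `PositiveMapKantorovichInequalities.affine_le_smul_sq`); the
  one-direction «(iv) with `A⁻¹`» consequence `Φ(A⁻²) ≤ ((M+m)²/(4Mm)) Φ(A⁻¹)²` (`map_inv_sq_le_smul_sq_map_inv`).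
* § 4 (over `ℂ`) **Kadison / Choi–Davis (1) for `f(t) = t²`**: **`kadison_of_isHermitian`** (`Φ(A)² ≤ Φ(A²)` for every
  HERMITIAN `A` — the tree's `PositiveMapKadisonChoiInequalities.kadison` has `A ⪰ 0`; shift `A + cI ⪰ 0`), and the
  two-sided **`sq_map_le_map_sq_le`** (`Φ(A)² ≤ Φ(A²) ≤ Φ(A)² + ¼(M−m)²I`).

NOT covered: the equivalences (i)⇔(ii)⇔(iii) of Theorem 3.1 (geometric mean `♯`, states), Sharma–Kumari's own
numerical-range results.
-/

noncomputable section

open Matrix Finset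
open scoped ComplexOrder MatrixOrder
open Literature.LinearAlgebra.Matrix.MatrixKantorovich (sq_le_of_eigenvalues_le)
open Literature.LinearAlgebra.Matrix.LoewnerEigenvalueBounds (le_eigenvalues_of_posSemidef eigenvalues_le_of_posSemidef)
open Literature.LinearAlgebra.Matrix.PositiveMapKantorovichInequalities (map_loewner affine_le_smul_sq
  posDef_of_sub_smul_one)

namespace Literature.LinearAlgebra.Matrix.BhatiaDavisPositiveMapInequality

variable {𝕜 : Type*} [RCLike 𝕜] {n k : Type*} [Fintype n] [DecidableEq n] [Fintype k] [DecidableEq k]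

/-! ## § 0. Plumbing -/

section Plumbing

variable {X Y Z : Matrix n n 𝕜}

omit [DecidableEq n] in
/-- `rX ⪰ 0` for a real `r ≥ 0` and `X ⪰ 0`. [folklore] -/
private theorem real_smul_posSemidef {r : ℝ} (hr : 0 ≤ r) (hX : X.PosSemidef) : ((r : 𝕜) • X).PosSemidef := by
  refine PosSemidef.of_dotProduct_mulVec_nonneg ?_ fun x => ?_
  · unfold Matrix.IsHermitian
    rw [conjTranspose_smul, hX.1.eq, RCLike.star_def, RCLike.conj_ofReal]
  · rw [smul_mulVec, dotProduct_smul, smul_eq_mul]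
    exact mul_nonneg (RCLike.ofReal_nonneg.mpr hr) (hX.dotProduct_mulVec_nonneg x)

omit [Fintype n] [DecidableEq n] in
/-- Loewner transitivity. [folklore] -/
private theorem loewner_trans (h₁ : (Y - X).PosSemidef) (h₂ : (Z - Y).PosSemidef) : (Z - X).PosSemidef := by
  have h := h₁.add h₂
  rwa [sub_add_sub_cancel'] at h

omit [Fintype n] in
/-- «`mI ≤ A`» makes `A` Hermitian. [folklore] -/
private theorem isHermitian_of_sub_smul_one {A : Matrix n n 𝕜} {m : ℝ}
    (hmA : (A - (m : 𝕜) • (1 : Matrix n n 𝕜)).PosSemidef) : A.IsHermitian := by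
  have h : A = (A - (m : 𝕜) • (1 : Matrix n n 𝕜)) + (m : 𝕜) • (1 : Matrix n n 𝕜) := (sub_add_cancel _ _).symm
  rw [h]
  refine hmA.1.add ?_
  unfold Matrix.IsHermitian
  rw [conjTranspose_smul, conjTranspose_one, RCLike.star_def, RCLike.conj_ofReal]

omit [DecidableEq n] in
/-- The square of a Hermitian matrix is `⪰ 0`. [folklore] -/
private theorem posSemidef_mul_self {H : Matrix n n 𝕜} (hH : H.IsHermitian) : (H * H).PosSemidef := by
  have h := posSemidef_conjTranspose_mul_self H
  rwa [hH.eq] at h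

end Plumbing

section Maps

variable (Φ : Matrix n n 𝕜 →ₗ[𝕜] Matrix k k 𝕜)

/-! ## § 1. (3.9) `mI ≤ Φ(A) ≤ MI`, and `Φ(A²) ≤ (M+m)Φ(A) − MmI` -/

omit [Fintype n] [Fintype k] in
/-- **(3.9): «`m ≤ A ≤ M` therefore `m ≤ Φ(A) ≤ M`»** for a unital positive linear map `Φ`.
[cite: SharmaKumari2015, (3.9), p. 7] -/
theorem map_loewner_bounds (hΦ : ∀ X, X.PosSemidef → (Φ X).PosSemidef) (hΦ1 : Φ 1 = 1) {A : Matrix n n 𝕜}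
    {m M : ℝ} (hmA : (A - (m : 𝕜) • (1 : Matrix n n 𝕜)).PosSemidef) (hAM : ((M : 𝕜) • (1 : Matrix n n 𝕜) - A).PosSemidef) :
    (Φ A - (m : 𝕜) • (1 : Matrix k k 𝕜)).PosSemidef ∧ ((M : 𝕜) • (1 : Matrix k k 𝕜) - Φ A).PosSemidef := by
  refine ⟨?_, ?_⟩
  · have h := map_loewner Φ hΦ hmA
    rwa [map_smul, hΦ1] at h
  · have h := map_loewner Φ hΦ hAM
    rwa [map_smul, hΦ1] at h

omit [Fintype k] in
/-- **`Φ(A²) ≤ (M+m)Φ(A) − MmI`** for Hermitian `A` with `mI ≤ A ≤ MI` and `Φ` unital positive: the image of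
`A² ≤ (M+m)A − MmI` (`(MI − A)(A − mI) ⪰ 0`, commuting factors). [cite: SharmaKumari2015, (3.10) (equivalent form,
`(M − Φ(A))(Φ(A) − m) = (M+m)Φ(A) − Mm − Φ(A)²`), p. 7] -/
theorem map_sq_le_affine (hΦ : ∀ X, X.PosSemidef → (Φ X).PosSemidef) (hΦ1 : Φ 1 = 1) {A : Matrix n n 𝕜}
    {m M : ℝ} (hmA : (A - (m : 𝕜) • (1 : Matrix n n 𝕜)).PosSemidef) (hAM : ((M : 𝕜) • (1 : Matrix n n 𝕜) - A).PosSemidef) :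
    (((M + m : ℝ) : 𝕜) • Φ A - ((M * m : ℝ) : 𝕜) • (1 : Matrix k k 𝕜) - Φ (A ^ 2)).PosSemidef := by
  have hA : A.IsHermitian := isHermitian_of_sub_smul_one hmA
  have h0 := sq_le_of_eigenvalues_le hA (le_eigenvalues_of_posSemidef hA hmA) (eigenvalues_le_of_posSemidef hA hAM)
  have h1 := hΦ _ h0
  rwa [map_sub, map_sub, map_smul, map_smul, hΦ1] at h1

/-! ## § 2. The Bhatia–Davis inequality -/

/-- **Bhatia–Davis (2000): `Φ(A²) − Φ(A)² ≤ (MI − Φ(A))(Φ(A) − mI)`** for every unital positive linear map `Φ` and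
Hermitian `A` with `mI ≤ A ≤ MI` (the two factors on the right commute; the right side is
`(M+m)Φ(A) − MmI − Φ(A)²`). [cite: SharmaKumari2015, (3.10) («Bhatia and Davis [3] have proved that …»), p. 7]
[cite: BhatiaDavis2000, Thm 1 (the matrix/positive-map form)] -/
theorem map_sq_sub_sq_map_le_mul (hΦ : ∀ X, X.PosSemidef → (Φ X).PosSemidef) (hΦ1 : Φ 1 = 1) {A : Matrix n n 𝕜}
    {m M : ℝ} (hmA : (A - (m : 𝕜) • (1 : Matrix n n 𝕜)).PosSemidef) (hAM : ((M : 𝕜) • (1 : Matrix n n 𝕜) - A).PosSemidef) :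
    (((M : 𝕜) • (1 : Matrix k k 𝕜) - Φ A) * (Φ A - (m : 𝕜) • (1 : Matrix k k 𝕜)) -
      (Φ (A ^ 2) - Φ A ^ 2)).PosSemidef := by
  have h := map_sq_le_affine Φ hΦ hΦ1 hmA hAM
  convert h using 1
  simp only [Matrix.sub_mul, Matrix.mul_sub, Matrix.smul_mul, Matrix.mul_smul, Matrix.one_mul, Matrix.mul_one,
    pow_two, RCLike.ofReal_add, RCLike.ofReal_mul, add_smul]
  module

/-- `(MI − C)(C − mI) ≤ ¼(M−m)²I` for a Hermitian `C`: the gap is `(C − ½(M+m)I)²`. [cite: SharmaKumari2015, (1.1) from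
(3.10), pp. 2, 7] -/
theorem mul_le_quarter_sq_smul_one {C : Matrix k k 𝕜} (hC : C.IsHermitian) (m M : ℝ) :
    ((((M - m) ^ 2 / 4 : ℝ) : 𝕜) • (1 : Matrix k k 𝕜) -
      ((M : 𝕜) • (1 : Matrix k k 𝕜) - C) * (C - (m : 𝕜) • (1 : Matrix k k 𝕜))).PosSemidef := by
  have hH : (C - (((M + m) / 2 : ℝ) : 𝕜) • (1 : Matrix k k 𝕜)).IsHermitian := by
    unfold Matrix.IsHermitian
    rw [conjTranspose_sub, conjTranspose_smul, conjTranspose_one, hC.eq]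
    simp
  have h := posSemidef_mul_self hH
  convert h using 1
  simp only [Matrix.sub_mul, Matrix.mul_sub, Matrix.smul_mul, Matrix.mul_smul, Matrix.one_mul, Matrix.mul_one,
    smul_sub, smul_smul]
  push_cast
  module

/-- **Bhatia–Davis (2000), the variance bound (1.1): `Φ(A²) − Φ(A)² ≤ ¼(M − m)²I`** for every unital positive linear
map `Φ` and Hermitian `A` with spectrum in `[m, M]` (`mI ≤ A ≤ MI`). [cite: SharmaKumari2015, (1.1) («Bhatia and Davis
[3] have proved that …»), p. 2] [cite: BhatiaDavis2000, Thm 1] -/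
theorem map_sq_sub_sq_map_le (hΦ : ∀ X, X.PosSemidef → (Φ X).PosSemidef) (hΦ1 : Φ 1 = 1) {A : Matrix n n 𝕜}
    {m M : ℝ} (hmA : (A - (m : 𝕜) • (1 : Matrix n n 𝕜)).PosSemidef) (hAM : ((M : 𝕜) • (1 : Matrix n n 𝕜) - A).PosSemidef) :
    ((((M - m) ^ 2 / 4 : ℝ) : 𝕜) • (1 : Matrix k k 𝕜) - (Φ (A ^ 2) - Φ A ^ 2)).PosSemidef := by
  have hA : A.IsHermitian := isHermitian_of_sub_smul_one hmA
  have hC : (Φ A).IsHermitian := by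
    have h := (map_loewner_bounds Φ hΦ hΦ1 hmA hAM).1
    exact isHermitian_of_sub_smul_one h
  exact loewner_trans (map_sq_sub_sq_map_le_mul Φ hΦ hΦ1 hmA hAM) (mul_le_quarter_sq_smul_one hC m M)

/-! ## § 3. The reverse Kadison inequality `Φ(A²) ≤ ((M+m)²/(4Mm)) Φ(A)²` -/

/-- **(4) / (7) / Theorem 3.1 (iv): `Φ(A²) ≤ ((M+m)²/(4Mm)) Φ(A)²`** for `0 < mI ≤ A ≤ MI` and every unital positive
linear map `Φ` (the Kantorovich-type reverse of Kadison's `Φ(A)² ≤ Φ(A²)`): `Φ(A²) ≤ (M+m)Φ(A) − MmI ≤ KΦ(A)²`,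
`K = (M+m)²/(4Mm) = ((M+m)/(2√(Mm)))²`. [cite: SababhehEtAl2019, (4) p. 3; Theorem 3.1 (iv) p. 5; (7) p. 7] -/
theorem map_sq_le_smul_sq_map (hΦ : ∀ X, X.PosSemidef → (Φ X).PosSemidef) (hΦ1 : Φ 1 = 1) {A : Matrix n n 𝕜}
    {m M : ℝ} (hm : 0 < m) (hmM : m ≤ M) (hmA : (A - (m : 𝕜) • (1 : Matrix n n 𝕜)).PosSemidef)
    (hAM : ((M : 𝕜) • (1 : Matrix n n 𝕜) - A).PosSemidef) :
    ((((M + m) ^ 2 / (4 * (M * m)) : ℝ) : 𝕜) • Φ A ^ 2 - Φ (A ^ 2)).PosSemidef := by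
  have hMm : 0 < M * m := mul_pos (hm.trans_le hmM) hm
  have hC : (Φ A).IsHermitian := isHermitian_of_sub_smul_one (map_loewner_bounds Φ hΦ hΦ1 hmA hAM).1
  exact loewner_trans (map_sq_le_affine Φ hΦ hΦ1 hmA hAM) (affine_le_smul_sq hC hMm)

/-- «(iv) with `A` replaced by `A⁻¹`»: **`Φ(A⁻²) ≤ ((M+m)²/(4Mm)) Φ(A⁻¹)²`** for `0 < mI ≤ A ≤ MI` (`M⁻¹I ≤ A⁻¹ ≤ m⁻¹I`
and the Kantorovich constant of `[M⁻¹, m⁻¹]` is again `(M+m)²/(4Mm)`). [cite: SababhehEtAl2019, proof of Theorem 3.1,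
«(iv) ⇒ (i)» first display, p. 6] -/
theorem map_inv_sq_le_smul_sq_map_inv (hΦ : ∀ X, X.PosSemidef → (Φ X).PosSemidef) (hΦ1 : Φ 1 = 1)
    {A : Matrix n n 𝕜} {m M : ℝ} (hm : 0 < m) (hmM : m ≤ M) (hmA : (A - (m : 𝕜) • (1 : Matrix n n 𝕜)).PosSemidef)
    (hAM : ((M : 𝕜) • (1 : Matrix n n 𝕜) - A).PosSemidef) :
    ((((M + m) ^ 2 / (4 * (M * m)) : ℝ) : 𝕜) • Φ A⁻¹ ^ 2 - Φ (A⁻¹ ^ 2)).PosSemidef := by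
  have hM : 0 < M := hm.trans_le hmM
  obtain ⟨h1, h2⟩ := Literature.LinearAlgebra.Matrix.PositiveMapKantorovichInequalities.inv_bounds hm hmM hmA hAM
  have h := map_sq_le_smul_sq_map Φ hΦ hΦ1 (inv_pos.mpr hM) (inv_anti₀ hm hmM) h1 h2
  have hK : (m⁻¹ + M⁻¹) ^ 2 / (4 * (m⁻¹ * M⁻¹)) = (M + m) ^ 2 / (4 * (M * m)) := by
    field_simp
  rwa [hK] at h

end Maps

/-! ## § 4. Kadison's inequality for Hermitian `A` (over `ℂ`), and the two-sided bound -/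

section Complex

variable {n k : Type*} [Fintype n] [DecidableEq n] [Fintype k] [DecidableEq k]
  (Φ : Matrix n n ℂ →ₗ[ℂ] Matrix k k ℂ)

/-- **Kadison's inequality (the Choi–Davis inequality (1) for `f(t) = t²`): `Φ(A)² ≤ Φ(A²)` for every HERMITIAN `A`**
and every unital positive linear map `Φ` (the tree's `PositiveMapKadisonChoiInequalities.kadison` is the case `A ⪰ 0`;
for Hermitian `A` apply it to `A + cI ⪰ 0`, `c = −λ_min(A)`: the shift cancels, `Φ((A+cI)²) − Φ(A+cI)² =
Φ(A²) − Φ(A)²`). [cite: SababhehEtAl2019, (1) (Choi–Davis) with the operator convex `f(t) = t²`, p. 3] -/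
theorem kadison_of_isHermitian (hΦ : ∀ X, X.PosSemidef → (Φ X).PosSemidef) (hΦ1 : Φ 1 = 1) {A : Matrix n n ℂ}
    (hA : A.IsHermitian) : (Φ (A ^ 2) - Φ A ^ 2).PosSemidef := by
  -- a shift `B = A − cI ⪰ 0` with `c ≤ λ_i(A)` for all `i`
  obtain ⟨c, hc⟩ : ∃ c : ℝ, ∀ i, c ≤ hA.eigenvalues i := by
    rcases isEmpty_or_nonempty n with hn | hn
    · exact ⟨0, fun i => (IsEmpty.false i).elim⟩
    · exact ⟨univ.inf' univ_nonempty hA.eigenvalues, fun i => inf'_le _ (mem_univ i)⟩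
  have hB : (A - (c : ℂ) • (1 : Matrix n n ℂ)).PosSemidef := by
    rcases isEmpty_or_nonempty n with hn | hn
    · rw [Subsingleton.elim (A - (c : ℂ) • (1 : Matrix n n ℂ)) 0]
      exact PosSemidef.zero
    · exact Literature.LinearAlgebra.Matrix.posSemidef_sub_smul_one hA c hc
  have h := Literature.LinearAlgebra.Matrix.PositiveMapKadisonChoiInequalities.kadison Φ hΦ hΦ1 hB
  convert h using 1
  simp only [Matrix.sub_mul, Matrix.mul_sub, Matrix.smul_mul, Matrix.mul_smul, Matrix.one_mul, Matrix.mul_one,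
    pow_two, map_sub, map_smul, hΦ1]
  module

/-- **`Φ(A)² ≤ Φ(A²) ≤ Φ(A)² + ¼(M − m)²I`** for Hermitian `A` with `mI ≤ A ≤ MI` and `Φ` unital positive: Kadison's
inequality and the Bhatia–Davis variance bound together («`0 ≤ Φ(A²) − Φ(A)² ≤ (M−m)²/4`»).
[cite: SharmaKumari2015, (1.1), p. 2] [cite: SababhehEtAl2019, (1), p. 3] -/
theorem sq_map_le_map_sq_le (hΦ : ∀ X, X.PosSemidef → (Φ X).PosSemidef) (hΦ1 : Φ 1 = 1) {A : Matrix n n ℂ}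
    {m M : ℝ} (hmA : (A - (m : ℂ) • (1 : Matrix n n ℂ)).PosSemidef) (hAM : ((M : ℂ) • (1 : Matrix n n ℂ) - A).PosSemidef) :
    (Φ (A ^ 2) - Φ A ^ 2).PosSemidef ∧
      ((Φ A ^ 2 + (((M - m) ^ 2 / 4 : ℝ) : ℂ) • (1 : Matrix k k ℂ)) - Φ (A ^ 2)).PosSemidef := by
  refine ⟨kadison_of_isHermitian Φ hΦ hΦ1 (isHermitian_of_sub_smul_one hmA), ?_⟩
  have h := map_sq_sub_sq_map_le Φ hΦ hΦ1 hmA hAM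
  have e : Φ A ^ 2 + (((M - m) ^ 2 / 4 : ℝ) : ℂ) • (1 : Matrix k k ℂ) - Φ (A ^ 2) =
      (((M - m) ^ 2 / 4 : ℝ) : ℂ) • (1 : Matrix k k ℂ) - (Φ (A ^ 2) - Φ A ^ 2) := by abel
  rw [e]
  exact h

end Complex

end Literature.LinearAlgebra.Matrix.BhatiaDavisPositiveMapInequality
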